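import Literature.AlgebraicGeometry.Resolution.CartierDivisorExcCurveH0
import Literature.AlgebraicGeometry.Modules.AffineLocalizingClosure
import Mathlib.AlgebraicGeometry.FunctionField
import HarnessLib

/-!
# `h⁰(𝒪_X/𝓘𝓚) = h⁰(𝒪_X/𝓘) + h⁰(𝒪_X/𝓚)` for an invertible ideal `𝓘` and a zero-dimensional `V(𝓚)`
# (Lipman 1969, §13: additivity of `χ` along `0 → 𝓘/𝓘𝓚 → 𝒪/𝓘𝓚 → 𝒪/𝓘 → 0`, with `𝓘/𝓘𝓚 ≅ 𝒪/𝓚` locally)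

Topic: `Literature/AlgebraicGeometry/Resolution`.  PROVED, fact-free, definition-free.  J. Lipman, *Rational
singularities …*, Publ. Math. IHÉS 36 (1969), §13 (p. 223) computes Euler characteristics of curves `E + F =
V(𝒪(−E)𝒪(−F))` from the exact sequences `0 → 𝒪(−E)/𝒪(−E−F) → 𝒪_{E+F} → 𝒪_E → 0` with `𝒪(−E)/𝒪(−E)𝒪(−F) ≅
𝒪_F ⊗ 𝒪(−E)`; when `F` is replaced by a ZERO-dimensional `V(𝓚)` the twist is invisible (`𝓘 ⊗ 𝒪/𝓚 ≅ 𝒪/𝓚`, `𝓘`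
being locally principal) and `H¹(𝓘/𝓘𝓚) = 0` (finite support), whence the unconditional additivity

  `h0 π (𝓘 * 𝓚) = h0 π 𝓘 + h0 π 𝓚`   (`𝓘` invertible, `supp 𝓚` a finite set of closed points),

the `h⁰`-form of `χ(𝒪/𝓘𝓚) = χ(𝒪/𝓘) + χ(𝒪/𝓚)` — e.g. `h⁰(𝒪/𝓘_E(𝓘_F + 𝓘_G)) = h⁰(E) + h⁰(𝒪_{F∩G})`, the step of
bi-additivity `(E·(F+G)) = (E·F) + (E·G)` (Prop. (13.1) b)) for curves `F`, `G` without common component.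

* §1 `shortExact_kernel_idealQuot` — `0 → ker → 𝒪/𝓘𝓚 → 𝒪/𝓘 → 0`; `kernel_sections_eq_zero_of_disjoint` — the kernel
  is supported on `supp 𝓚`; `length_kernel_sections_eq_length_quotient` — on an affine `U` with `𝓘(U) = (t)`, `t` a
  non-zero-divisor, `ℓ_T Γ(U, ker) = ℓ_T(Γ(U, 𝒪)/𝓚(U))` (`r ↦ t·r`);
* §2 **`h0_mul_eq_add_of_finite_support`** — the displayed formula on a quasi-compact integral `T`-scheme (basic
  opens of Cartier charts isolating the points of `supp 𝓚`; `Morphisms/FinitelySupportedSections`,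
  `Resolution/H0ZeroDimensionalSubscheme`, `Resolution/RationalResolutionH0InclusionExclusion` §2).

## References
* J. Lipman, Publ. Math. IHÉS 36 (1969), §13, Prop. (13.1) b), d) and proof (p. 223). [Lipman1969]
* R. Hartshorne, *Algebraic Geometry* (1977), II Ex. 1.17, II Prop. 5.7. [Hartshorne1977]
-/

noncomputable section

-- `TopCat.Presheaf`/`Scheme.Modules` are not reducible (as in Mathlib's `AlgebraicGeometry/Modules`).
set_option backward.isDefEq.respectTransparency false

open CategoryTheory CategoryTheory.Limits AlgebraicGeometry TopologicalSpace IsLocalRing Opposite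
open Literature.AlgebraicGeometry.Morphisms Literature.AlgebraicGeometry.Modules
open Literature.AlgebraicGeometry.Motives
open Scheme.IdealSheafData

universe u

namespace Literature.AlgebraicGeometry.Resolution

variable {T : Type u} [CommRing T] {X : Scheme.{u}} (π : X ⟶ Spec (.of T))

/-! ## §1 The kernel `𝓘/𝓘𝓚` of `𝒪/𝓘𝓚 → 𝒪/𝓘` -/

section Kernel

variable (𝓘 𝓚 : X.IdealSheafData)
  (q : idealQuot (unitModule X) (𝓘 * 𝓚) ⟶ idealQuot (unitModule X) 𝓘)
  (hq : idealQuotπ (unitModule X) (𝓘 * 𝓚) ≫ q = idealQuotπ (unitModule X) 𝓘)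

include hq in
/-- `𝒪/𝓘𝓚 → 𝒪/𝓘` is an epimorphism. [folklore] -/
private theorem epi_q : Epi q := by
  refine epi_of_surjective_app_of_isAffineOpen _ fun V hV => ?_
  intro u
  obtain ⟨c, rfl⟩ := idealQuotπ_unit_app_surjective 𝓘 hV u
  exact ⟨(idealQuotπ (unitModule X) (𝓘 * 𝓚)).app V c, app_idealQuotπ_app_of_comp_eq hq V c⟩

include hq in
/-- **`0 → ker → 𝒪/𝓘𝓚 → 𝒪/𝓘 → 0` is short exact** (Lipman's `0 → 𝒪(−E)/𝒪(−E−F) → 𝒪_{E+F} → 𝒪_E → 0`, §13 p. 223).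
[cite: Lipman1969, Section 13 (p. 223)] -/
theorem shortExact_kernel_idealQuot :
    (ShortComplex.mk (kernel.ι q) q (kernel.condition q)).ShortExact :=
  haveI := epi_q 𝓘 𝓚 q hq
  ShortComplex.ShortExact.mk' (ShortComplex.exact_kernel q) inferInstance inferInstance

include hq in
/-- **The kernel `𝓘/𝓘𝓚` is supported on `supp 𝓚`**: its sections over an open disjoint from `supp 𝓚` vanish (on an affine
`V` missing `supp 𝓚`, `𝓚(V) = (1)` and `(𝓘𝓚)(V) = 𝓘(V)`, so `𝒪/𝓘𝓚 → 𝒪/𝓘` is injective there).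
[cite: Hartshorne1977, II Ex. 1.17] -/
theorem kernel_sections_eq_zero_of_disjoint (W : X.Opens) (hW : Disjoint (W : Set X) (𝓚.support : Set X))
    (s : MSections π (kernel q) W) : s = 0 := by
  apply kernel_ι_app_injective q W
  rw [map_zero]
  refine section_eq_zero_of_locally _ _ fun x hx => ?_
  obtain ⟨V, hV, hxV, hVW⟩ := Opens.isBasis_iff_nbhd.mp X.isBasis_affineOpens hx
  refine ⟨V, hVW, hxV, ?_⟩
  have hVd : Disjoint (V : Set X) (𝓚.support : Set X) := Set.disjoint_of_subset_left hVW hW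
  set t := (idealQuot (unitModule X) (𝓘 * 𝓚)).presheaf.map (homOfLE hVW).op ((kernel.ι q).app W s) with ht
  obtain ⟨c, hc⟩ := idealQuotπ_unit_app_surjective (𝓘 * 𝓚) hV t
  -- `q t = 0`, so `c ∈ 𝓘(V) = (𝓘𝓚)(V)`
  have hqt : q.app V t = 0 := by
    have hnat : q.app V t = (idealQuot (unitModule X) 𝓘).presheaf.map (homOfLE hVW).op
        (q.app W ((kernel.ι q).app W s)) :=
      ConcreteCategory.congr_hom (q.mapPresheaf.naturality (homOfLE hVW).op) _
    rw [hnat, app_kernel_ι_app, map_zero]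
  rw [← hc, app_idealQuotπ_app_of_comp_eq hq V c, idealQuotπ_unit_app_eq_zero_iff 𝓘 hV] at hqt
  rw [← hc, idealQuotπ_unit_app_eq_zero_iff (𝓘 * 𝓚) hV, ideal_mul, Pi.mul_apply,
    ideal_eq_top_of_disjoint_support' 𝓚 hV hVd, Ideal.mul_top]
  exact hqt

include hq in
/-- **On an affine open `U` where `𝓘(U) = (t)` with `t` a non-zero-divisor, `ℓ_T Γ(U, 𝓘/𝓘𝓚) = ℓ_T(Γ(U, 𝒪)/𝓚(U))`**:
`Γ(U, 𝓘/𝓘𝓚) = ker(Γ(U,𝒪)/(t)𝓚(U) → Γ(U,𝒪)/(t)) = (t)/(t)𝓚(U) ≅ Γ(U,𝒪)/𝓚(U)` via `r ↦ t r`.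
[cite: Lipman1969, Section 13 (p. 223)] -/
theorem length_kernel_sections_eq_length_quotient {U : X.Opens} (hU : IsAffineOpen U) (t : Γ(X, U))
    (ht : 𝓘.ideal ⟨U, hU⟩ = Ideal.span {t}) (ht0 : t ∈ nonZeroDivisors Γ(X, U)) :
    Module.length T (MSections π (kernel q) U) =
      Module.length T (Sections π U ⧸ (𝓚.ideal ⟨U, hU⟩).comap (Sections.equiv π U).toRingHom) := by
  set K' : Ideal (Sections π U) := (𝓚.ideal ⟨U, hU⟩).comap (Sections.equiv π U).toRingHom with hK'
  -- `Γ(U, ker q) ≅ ker (q_U)`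
  set ι' : MSections π (kernel q) U →ₗ[T] MSections π (idealQuot (unitModule X) (𝓘 * 𝓚)) U :=
    MSections.app π (kernel.ι q) U with hι'
  set qU : MSections π (idealQuot (unitModule X) (𝓘 * 𝓚)) U →ₗ[T] MSections π (idealQuot (unitModule X) 𝓘) U :=
    MSections.app π q U with hqU
  have hinj : Function.Injective ι' := kernel_ι_app_injective q U
  have hrange : LinearMap.range ι' = LinearMap.ker qU := by
    ext s
    constructor
    · rintro ⟨m, rfl⟩
      exact app_kernel_ι_app q U m
    · intro hs
      obtain ⟨m, hm⟩ := exists_kernel_ι_app_eq q U s hs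
      exact ⟨m, hm⟩
  -- `ψ : r ↦ class of t·r`
  set t' : Sections π U := t with ht'
  let e0 : MSections π (unitModule X) U ≃ₗ[T] Sections π U :=
    { toFun := fun m => m, invFun := fun m => m, map_add' := fun _ _ => rfl, map_smul' := fun _ _ => rfl,
      left_inv := fun _ => rfl, right_inv := fun _ => rfl }
  let ψ : Sections π U →ₗ[T] MSections π (idealQuot (unitModule X) (𝓘 * 𝓚)) U :=
    (MSections.app π (idealQuotπ (unitModule X) (𝓘 * 𝓚)) U) ∘ₗ e0.symm.toLinearMap ∘ₗ LinearMap.mulLeft T t'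
  have hψ : ∀ r : Sections π U,
      ψ r = (idealQuotπ (unitModule X) (𝓘 * 𝓚)).app U
        (show Γ(unitModule X, U) from (t * (show Γ(X, U) from r) : Γ(X, U))) := fun r => rfl
  -- `range ψ = ker qU`
  have hrangeψ : LinearMap.range ψ = LinearMap.ker qU := by
    ext s
    constructor
    · rintro ⟨r, rfl⟩
      set r' : Γ(X, U) := r with hr'
      have hmem : t * r' ∈ 𝓘.ideal ⟨U, hU⟩ := by
        rw [ht]
        exact Ideal.mul_mem_right r' _ (Ideal.mem_span_singleton_self t)
      have h1 : (idealQuotπ (unitModule X) 𝓘).app U (show Γ(unitModule X, U) from t * r') = 0 :=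
        (idealQuotπ_unit_app_eq_zero_iff 𝓘 hU _).mpr hmem
      rw [LinearMap.mem_ker, hqU, MSections.app_apply, hψ, app_idealQuotπ_app_of_comp_eq hq U]
      exact h1
    · intro hs
      obtain ⟨c, rfl⟩ := idealQuotπ_unit_app_surjective (𝓘 * 𝓚) hU s
      rw [LinearMap.mem_ker, hqU, MSections.app_apply, app_idealQuotπ_app_of_comp_eq hq U,
        idealQuotπ_unit_app_eq_zero_iff 𝓘 hU, ht] at hs
      set c' : Γ(X, U) := c with hc'
      have hs' : c' ∈ Ideal.span {t} := hs
      obtain ⟨r, hr⟩ := Ideal.mem_span_singleton'.mp hs'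
      refine ⟨(show Sections π U from r), ?_⟩
      rw [hψ]
      have hc : (show Γ(unitModule X, U) from (t * r : Γ(X, U))) = c := by
        have e : t * r = c' := by rw [mul_comm]; exact hr
        exact e
      exact congrArg _ hc
  -- `ker ψ = 𝓚(U)`
  have hkerψ : LinearMap.ker ψ = K'.restrictScalars T := by
    ext r
    rw [LinearMap.mem_ker, hψ, idealQuotπ_unit_app_eq_zero_iff (𝓘 * 𝓚) hU, ideal_mul, Pi.mul_apply, ht,
      Submodule.restrictScalars_mem, hK', Ideal.mem_comap]
    change t * (show Γ(X, U) from r) ∈ Ideal.span {t} * 𝓚.ideal ⟨U, hU⟩ ↔ (show Γ(X, U) from r) ∈ 𝓚.ideal ⟨U, hU⟩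
    rw [Ideal.mem_span_singleton_mul]
    constructor
    · rintro ⟨z, hz, hzr⟩
      have : z = r := (mul_cancel_left_mem_nonZeroDivisors ht0).mp hzr
      rw [← this]
      exact hz
    · intro hr
      exact ⟨r, hr, rfl⟩
  -- assemble
  calc Module.length T (MSections π (kernel q) U)
      = Module.length T (LinearMap.range ι') := (LinearEquiv.ofInjective ι' hinj).length_eq
    _ = Module.length T (LinearMap.ker qU) := by rw [hrange]
    _ = Module.length T (LinearMap.range ψ) := by rw [hrangeψ]
    _ = Module.length T (Sections π U ⧸ LinearMap.ker ψ) := (ψ.quotKerEquivRange).length_eq.symm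
    _ = Module.length T (Sections π U ⧸ K'.restrictScalars T) := by rw [hkerψ]
    _ = Module.length T (Sections π U ⧸ K') := (Submodule.Quotient.restrictScalarsEquiv T K').length_eq

end Kernel

/-! ## §2 `h⁰(𝒪/𝓘𝓚) = h⁰(𝒪/𝓘) + h⁰(𝒪/𝓚)` -/

section Main

/-- A quasi-compact scheme has a finite affine open cover indexed by a type in its own universe. [folklore] -/
private theorem exists_finite_isAffineOpen_cover''' (X : Scheme.{u}) [CompactSpace X] :
    ∃ (κ : Type u) (_ : Finite κ) (U : κ → X.Opens), (∀ i, IsAffineOpen (U i)) ∧ ⨆ i, U i = ⊤ := by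
  obtain ⟨s, hs, e⟩ := (isCompact_iff_finite_and_eq_biUnion_affineOpens (U := (⊤ : X.Opens))).mp
    (by simpa using isCompact_univ)
  haveI := hs.to_subtype
  refine ⟨s, inferInstance, fun i => i.1.1, fun i => i.1.2, ?_⟩
  rw [iSup_subtype]
  exact e.symm

variable [IsIntegral X]

/-- **Charts adapted to `𝓘` and `Z`**: for an invertible ideal sheaf `𝓘`, a finite set `Z` of closed points and
`p : X`, an affine open `U ∋ p` meeting `Z` at most in `p`, on which `𝓘(U) = (t)` with `t` a non-zero-divisor
(a basic open of a Cartier chart of `𝓘` at `p`). [folklore] -/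
private theorem exists_cartier_chart_isolating (𝓘 : X.IdealSheafData) (hI : IsEffectiveCartier 𝓘) {Z : Set X} (hZ : Z.Finite)
    (hZcl : ∀ p ∈ Z, IsClosed ({p} : Set X)) (p : X) :
    ∃ (U : X.Opens) (hU : IsAffineOpen U), p ∈ U ∧ (∀ q ∈ Z, q ∈ U → q = p) ∧
      ∃ t : Γ(X, U), 𝓘.ideal ⟨U, hU⟩ = Ideal.span {t} ∧ t ∈ nonZeroDivisors Γ(X, U) := by
  -- the open complement of `Z ∖ {p}` and a basic open of the chart inside it
  have hcl : IsClosed (Z \ {p}) := by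
    have hsub : Z \ {p} ⊆ Z := fun q hq => hq.1
    have h := (hZ.subset hsub).isClosed_biUnion fun q (hq : q ∈ Z \ {p}) => hZcl q hq.1
    rwa [Set.biUnion_of_singleton] at h
  set W : X.Opens := ⟨(Z \ {p})ᶜ, hcl.isOpen_compl⟩ with hW
  have hpW : p ∈ W := fun h => h.2 rfl
  set V := CartierDivisor.cartierChart 𝓘 hI p with hV
  obtain ⟨f, hfW, hpf⟩ := V.2.exists_basicOpen_le ⟨p, hpW⟩ (CartierDivisor.mem_cartierChart 𝓘 hI p)
  refine ⟨X.basicOpen f, V.2.basicOpen f, hpf, fun q hq hqU => ?_, ?_⟩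
  · by_contra hqp
    exact hfW hqU ⟨hq, hqp⟩
  · set t := X.presheaf.map (homOfLE (X.basicOpen_le f)).op (CartierDivisor.cartierGen 𝓘 hI p) with ht
    refine ⟨t, ?_, ?_⟩
    · have h := 𝓘.map_ideal_basicOpen V f
      rw [CartierDivisor.ideal_cartierChart, Ideal.map_span, Set.image_singleton] at h
      exact h.symm
    · haveI : Nonempty (X.basicOpen f : X.Opens) := ⟨⟨p, hpf⟩⟩
      refine mem_nonZeroDivisors_of_ne_zero fun h0 => CartierDivisor.cartierGen_ne_zero 𝓘 hI p ?_
      apply AlgebraicGeometry.germ_injective_of_isIntegral (X := X) p (CartierDivisor.mem_cartierChart 𝓘 hI p)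
      rw [map_zero, ← TopCat.Presheaf.germ_res_apply X.presheaf (homOfLE (X.basicOpen_le f)) p hpf, ← ht, h0,
        map_zero]

/-- **`h⁰(𝒪_X/𝓘𝓚) = h⁰(𝒪_X/𝓘) + h⁰(𝒪_X/𝓚)` for an invertible ideal sheaf `𝓘` and an ideal sheaf `𝓚` supported
on finitely many closed points**, on a quasi-compact integral scheme over `Spec T`: the exact sequence
`0 → 𝓘/𝓘𝓚 → 𝒪/𝓘𝓚 → 𝒪/𝓘 → 0` has `H¹(𝓘/𝓘𝓚) = 0` (finite support), and `ℓ_T Γ(X, 𝓘/𝓘𝓚) = h⁰(𝒪/𝓚)` since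
`𝓘/𝓘𝓚 ≅ 𝒪/𝓚` near each point of `supp 𝓚` (`𝓘` locally principal). This is the additivity
`χ(𝒪_{C+D}) = χ(𝒪_C) + χ(𝒪_C(−D)|…)` of Lipman's §13 in the case of a zero-dimensional `V(𝓚)`, e.g.
`h⁰(𝒪_X/𝓘_E(𝓘_F + 𝓘_G)) = h⁰(E) + h⁰(𝒪_{F∩G})`. [cite: Lipman1969, Section 13 (p. 223)] [cite: Hartshorne1977, II Ex. 1.17] -/
theorem h0_mul_eq_add_of_finite_support [CompactSpace X] (𝓘 𝓚 : X.IdealSheafData) (hI : IsEffectiveCartier 𝓘)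
    {Z : Set X} (hZ : Z.Finite) (hZcl : ∀ p ∈ Z, IsClosed ({p} : Set X)) (hsupp : (𝓚.support : Set X) ⊆ Z) :
    h0 π (𝓘 * 𝓚) = h0 π 𝓘 + h0 π 𝓚 := by
  classical
  -- the quotient map and its kernel
  have hle : 𝓘 * 𝓚 ≤ 𝓘 := fun U => Ideal.mul_le_right
  let q : idealQuot (unitModule X) (𝓘 * 𝓚) ⟶ idealQuot (unitModule X) 𝓘 :=
    idealQuotDesc ((isKilledBy_idealQuot (unitModule X) 𝓘).anti hle) (idealQuotπ _ 𝓘)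
  have hq : idealQuotπ (unitModule X) (𝓘 * 𝓚) ≫ q = idealQuotπ (unitModule X) 𝓘 := idealQuotπ_desc _ _
  have hT := shortExact_kernel_idealQuot 𝓘 𝓚 q hq
  -- charts
  choose U hUaff hpU hU' t ht ht0 using fun p : X => exists_cartier_chart_isolating (X := X) 𝓘 hI hZ hZcl p
  -- a finite affine cover and `Ȟ¹(ker) = 0`
  obtain ⟨κ, _, V, hVaff, hVcov⟩ := exists_finite_isAffineOpen_cover''' X
  have hsuppK : ∀ W : X.Opens, Disjoint (W : Set X) Z → ∀ s : MSections π (kernel q) W, s = 0 :=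
    fun W hW s => kernel_sections_eq_zero_of_disjoint π 𝓘 𝓚 q hq W (hW.mono_right hsupp) s
  have hH1 : Subsingleton (CechMH1 π (kernel q) V) := CechMH1.subsingleton_of_finite_support π _ V hZ hZcl hsuppK
  have hK : IsAffineLocalizing (kernel q) :=
    IsAffineLocalizing.kernel q (isAffineLocalizing_idealQuot _ IsAffineLocalizing.unit)
      (isAffineLocalizing_idealQuot _ IsAffineLocalizing.unit)
  have hadd := length_MSections_eq_add_of_shortExact π V hVaff hVcov hT hK hH1
  -- `ℓ Γ(X, ker) = h0 𝓚`
  letI := hZ.fintype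
  have hker : Module.length T (MSections π (kernel q) ⊤) = h0 π 𝓚 := by
    rw [MSections.length_top_eq_sum_of_finite_support π (kernel q) hZcl hsuppK U (fun p _ => hpU p)
      (fun p _ q hq hq' => hU' p q hq hq') hZ,
      h0_eq_sum_length_quotient_of_support_subset π 𝓚 hZ hZcl hsupp U (fun p _ => hUaff p) (fun p _ => hpU p)
        fun p _ q hq hq' => hU' p q hq hq']
    exact Fintype.sum_congr _ _ fun p =>
      length_kernel_sections_eq_length_quotient π 𝓘 𝓚 q hq (hUaff p.1) (t p.1) (ht p.1) (ht0 p.1)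
  rw [h0_eq_length_MSections_idealQuot, h0_eq_length_MSections_idealQuot π 𝓘]
  change Module.length T (MSections π (idealQuot (unitModule X) (𝓘 * 𝓚)) ⊤) =
    Module.length T (MSections π (idealQuot (unitModule X) 𝓘) ⊤) + h0 π 𝓚
  rw [hadd, hker, add_comm]

end Main

end Literature.AlgebraicGeometry.Resolution

end
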